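import Summits.AtomisticToContinuum.Crystallization.Theorems.FreeSplittingCertificatesStrictSplittingRuleP1PayTail

/-!
# `StrictSplittingRule` (stmt-AtomisticToContinuum-12560): the (PAY) tail by DISTANCE — every ledger `≥ 44a` from the base is the kernel's; hypothesis (PAY) asked only over the sites WITHIN `44a` (P1 interpolant object, part 93)

Route `FreeSplittingCertificates`, crux r3 `StrictSplittingRule` (H12⋆ = `stub_coreJointCoercive`), unit b2b-freesplit-B gen 39.
VALUE = a sharper re-basing of part 92's endpoint.  Part 92's (PAY_fin) sums the far table's column over the whole `44a` index BOX
`Icc(p.1 ± 53) × Icc(p.2.1 ± 69) × Icc(p.2.2 ± 51)`, whose corners lie up to `≈ 113a` from `y_p` — beyond the `80a` enumeration radius of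
the certificate (`paycert.py`, HOME CERT §35), so that certificate's analytic lattice tail would still be load-bearing for the box sites
beyond `80a`.  The kernel bound of part 92 in fact controls EVERY ledger at distance `≥ 44a` (not only those outside the box), so here
(PAY) is re-based on DISTANCE, exactly like (S_fin) (part 83) and (B∃_fin) (part 90):
* **`payColumn_far_le`**: `(193/125)(2/5)a⁻⁴ · Σ'_{q : ‖y_q − y_p‖ ≥ 44a} p1RecTable … (q − p) s ≤ (3/200000)·p1BondW 1 p s` for ANY base `p` and offset `s`
  (summable; same chain as `payColumn_tail_le`);
* `payColumn_le_of_near`: the column over the sites of the box WITH `‖y_q − y_p‖ < 44a` `≤ p1Paym p s − (3/200000)·p1BondW 1 p s` ⇒ (PAY)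
  (every site within `44a` lies in the box, `fortyfour_le_of_not_mem_siteBox44`);
* **`coreJointCoercive_cell_of_certificates₁₂`**: part 92's endpoint with (PAY_fin) replaced by (PAY_near): the 54 column sums over the
  FINITELY MANY sites `q` of the box with `‖y_q − y_p‖ < 44a`.  Certificate side: such sites are all inside paycert's enumerated range
  (`≤ 80a`), so its per-site interval bounds ALONE imply (PAY_near) (`PAY_up ≥ enumerated part ≥ partial sum`, allowance check = HOME
  `check39`): paycert's analytic tail formula leaves the trust base entirely.
NOT a proof of H12⋆ (five finite hypotheses verified outside the kernel), NOT summit progress.  [folklore]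
-/

noncomputable section

open Set Function Metric MeasureTheory Filter Topology
open scoped BigOperators NNReal ENNReal Classical

namespace Summit.AtomisticToContinuum.Crystallization.Theorems.StrictSplittingRuleBirth

open Literature.MathematicalPhysics.StatisticalMechanics
open Summit.AtomisticToContinuum.Crystallization.Theorems.PalmUnimodularRigidity.LayeredLawsSelectHcp

/-- **THE (PAY) TAIL BY DISTANCE.**  For the hcp family minimiser `(a,h)`, ANY base site `p` and ANY offset `s`: the family
`q ↦ [44a ≤ ‖y_q − y_p‖]·p1RecTable … (par p) (q − p) s` is summable and `(193/125)(2/5)a⁻⁴` times its sum is `≤ (3/200000)·p1BondW 1 p s`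
(a far ledger's cell weights near `p` are `≤ |T|(88/83)⁶r⁻⁶·`, part 92; the lattice sum `Σ_{r ≥ 44a} r⁻⁶` is part 91's).  NOT a proof of H12⋆, NOT summit progress. -/
theorem payColumn_far_le {a h : ℝ} (ha : 0 < a) (hh : 0 < h) (hfam : HcpFamilyMin a h) (p s : ℤ × ℤ × ℤ) :
    Summable (fun q : ℤ × ℤ × ℤ =>
      if ‖hcpSite a h q - hcpSite a h p‖ < 44 * a then (0 : ℝ)
      else p1RecTable a h (p1SplitDensity (81 / 20 * a) (27 / 5 * a)) (decide (Even p.1)) (q - p) s) ∧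
    (193 / 125) * (2 / 5) / a ^ 4 * (∑' q : ℤ × ℤ × ℤ,
      if ‖hcpSite a h q - hcpSite a h p‖ < 44 * a then (0 : ℝ)
      else p1RecTable a h (p1SplitDensity (81 / 20 * a) (27 / 5 * a)) (decide (Even p.1)) (q - p) s) ≤
      3 / 200000 * p1BondW (fun _ => (1 : ℝ)) p s := by
  obtain ⟨hlo, hhi⟩ := ratioBox_of_hcpFamilyMin ha hh hfam
  obtain ⟨hA, -⟩ := hcpFamilyMin_enclosure ha hh hfam
  have ha1 : (97119 / 100000 : ℝ) ≤ a := by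
    rw [abs_sub_le_iff] at hA
    linarith [hA.2]
  set N := p1BondW (fun _ => (1 : ℝ)) p s with hN
  have hN0 : 0 ≤ N := p1BondW_nonneg (fun _ => zero_le_one) p s
  set I : ℝ := 4 * Real.pi * (((39 * a) ^ 3)⁻¹ / 3 + 5 / 4 * a * ((39 * a) ^ 4)⁻¹ + 5 / 4 * a ^ 2 * ((39 * a) ^ 5)⁻¹) with hIdef
  set φ : ℤ × ℤ × ℤ → ℝ := fun q =>
    if 44 * a ≤ ‖hcpSite a h q - hcpSite a h p‖ then ((‖hcpSite a h q - hcpSite a h p‖ ^ 2)⁻¹) ^ 3 else 0 with hφ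
  obtain ⟨hφs, hφle⟩ := hcpSite_tsum_far44_inv_pow_six_le ha hh hhi p
  set G : ℤ × ℤ × ℤ → ℝ := fun q =>
    if ‖hcpSite a h q - hcpSite a h p‖ < 44 * a then (0 : ℝ)
    else p1RecTable a h (p1SplitDensity (81 / 20 * a) (27 / 5 * a)) (decide (Even p.1)) (q - p) s with hG
  set C : ℝ := √3 * a ^ 2 * h / 12 * (88 / 83 : ℝ) ^ 6 * N with hC
  have hC0 : 0 ≤ C := by positivity
  have hG0 : ∀ q, 0 ≤ G q := fun q => by
    simp only [hG]
    split_ifs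
    · exact le_rfl
    · exact p1RecTable_splitDensity_nonneg ha hh p q s
  have hGle : ∀ q, G q ≤ C * φ q := by
    intro q
    simp only [hG, hφ]
    by_cases hq : ‖hcpSite a h q - hcpSite a h p‖ < 44 * a
    · rw [if_pos hq]
      exact mul_nonneg hC0 (by split_ifs <;> positivity)
    · have hfar : 44 * a ≤ ‖hcpSite a h q - hcpSite a h p‖ := not_lt.1 hq
      rw [if_neg hq, if_pos hfar]
      have h1 := p1RecTable_far_le ha hh hhi p q s hfar
      have h2 := inv_pow_shift_le ha hfar
      have hT : 0 ≤ √3 * a ^ 2 * h / 12 := by positivity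
      calc p1RecTable a h (p1SplitDensity (81 / 20 * a) (27 / 5 * a)) (decide (Even p.1)) (q - p) s
          ≤ √3 * a ^ 2 * h / 12 * (((‖hcpSite a h q - hcpSite a h p‖ - 5 / 2 * a) ^ 2)⁻¹) ^ 3 * N := h1
        _ ≤ √3 * a ^ 2 * h / 12 * ((88 / 83 : ℝ) ^ 6 * ((‖hcpSite a h q - hcpSite a h p‖ ^ 2)⁻¹) ^ 3) * N :=
            mul_le_mul_of_nonneg_right (mul_le_mul_of_nonneg_left h2 hT) hN0
        _ = C * ((‖hcpSite a h q - hcpSite a h p‖ ^ 2)⁻¹) ^ 3 := by simp only [hC]; ring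
  have hCφ : Summable fun q => C * φ q := hφs.mul_left C
  have hGs : Summable G := hCφ.of_nonneg_of_le hG0 hGle
  refine ⟨hGs, ?_⟩
  have hGt : ∑' q, G q ≤ C * (2 / (√3 * a ^ 2 * h) * I) := by
    calc ∑' q, G q ≤ ∑' q, C * φ q := Summable.tsum_le_tsum hGle hGs hCφ
      _ = C * ∑' q, φ q := tsum_mul_left
      _ ≤ C * (2 / (√3 * a ^ 2 * h) * I) := mul_le_mul_of_nonneg_left hφle hC0
  have hκ : (0 : ℝ) ≤ (193 / 125) * (2 / 5) / a ^ 4 := by positivity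
  refine (mul_le_mul_of_nonneg_left hGt hκ).trans ?_
  have h3 : (√3 : ℝ) ≠ 0 := by positivity
  have ha0 : a ≠ 0 := ha.ne'
  have hh0 : h ≠ 0 := hh.ne'
  set Q₀ : ℝ := (193 / 125) * (2 / 5) * (88 / 83 : ℝ) ^ 6 * (2 / 3) *
    (((39 : ℝ) ^ 3)⁻¹ / 3 + 5 / 4 * ((39 : ℝ) ^ 4)⁻¹ + 5 / 4 * ((39 : ℝ) ^ 5)⁻¹) with hQ₀
  have hQ : (193 / 125) * (2 / 5) / a ^ 4 * (C * (2 / (√3 * a ^ 2 * h) * I)) = N * (Real.pi * Q₀ / a ^ 7) := by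
    simp only [hC, hIdef, hQ₀]
    field_simp
    ring
  rw [hQ]
  have hQ0 : 0 < Q₀ := by rw [hQ₀]; positivity
  have ha7 : (97119 / 100000 : ℝ) ^ 7 ≤ a ^ 7 := pow_le_pow_left₀ (by norm_num) ha1 7
  have hnum : Real.pi * Q₀ / a ^ 7 ≤ 3 / 200000 := by
    rw [div_le_iff₀ (by positivity : (0 : ℝ) < a ^ 7)]
    calc Real.pi * Q₀ ≤ 3.1416 * Q₀ := mul_le_mul_of_nonneg_right Real.pi_lt_d4.le hQ0.le
      _ ≤ 3 / 200000 * (97119 / 100000 : ℝ) ^ 7 := by rw [hQ₀]; norm_num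
      _ ≤ 3 / 200000 * a ^ 7 := mul_le_mul_of_nonneg_left ha7 (by norm_num)
  calc N * (Real.pi * Q₀ / a ^ 7) ≤ N * (3 / 200000) := mul_le_mul_of_nonneg_left hnum hN0
    _ = 3 / 200000 * N := mul_comm _ _

/-- **Near column + kernel far part ⇒ (PAY).**  For ANY base `p` and ANY offset `s`: if the column sum over the sites `q` of the `44a` box WITH
`‖y_q − y_p‖ < 44a` is `≤ p1Paym p s − (3/200000)·p1BondW 1 p s`, then the INFINITE column sum of hypothesis (PAY) (part 90) is `≤ p1Paym p s`
(every site within `44a` lies in the box; the rest is `payColumn_far_le`). -/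
theorem payColumn_le_of_near {a h : ℝ} (ha : 0 < a) (hh : 0 < h) (hfam : HcpFamilyMin a h) (p s : ℤ × ℤ × ℤ)
    (hnear : (193 / 125) * (2 / 5) / a ^ 4 *
      (∑ q ∈ Finset.Icc (p.1 - 53) (p.1 + 53) ×ˢ (Finset.Icc (p.2.1 - 69) (p.2.1 + 69) ×ˢ Finset.Icc (p.2.2 - 51) (p.2.2 + 51)),
        if ‖hcpSite a h q - hcpSite a h p‖ < 44 * a then
          p1RecTable a h (p1SplitDensity (81 / 20 * a) (27 / 5 * a)) (decide (Even p.1)) (q - p) s else 0) ≤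
      p1Paym p s - 3 / 200000 * p1BondW (fun _ => (1 : ℝ)) p s) :
    (193 / 125) * (2 / 5) / a ^ 4 *
      (∑' q : ℤ × ℤ × ℤ, p1RecTable a h (p1SplitDensity (81 / 20 * a) (27 / 5 * a)) (decide (Even p.1)) (q - p) s) ≤ p1Paym p s := by
  have hlo := (ratioBox_of_hcpFamilyMin ha hh hfam).1
  obtain ⟨hGs, hGt⟩ := payColumn_far_le ha hh hfam p s
  set Box := Finset.Icc (p.1 - 53) (p.1 + 53) ×ˢ (Finset.Icc (p.2.1 - 69) (p.2.1 + 69) ×ˢ Finset.Icc (p.2.2 - 51) (p.2.2 + 51)) with hBox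
  set f : ℤ × ℤ × ℤ → ℝ := fun q => p1RecTable a h (p1SplitDensity (81 / 20 * a) (27 / 5 * a)) (decide (Even p.1)) (q - p) s with hf
  set nr : ℤ × ℤ × ℤ → ℝ := fun q => if ‖hcpSite a h q - hcpSite a h p‖ < 44 * a then f q else 0 with hnr
  have hsplit : ∀ q, f q = nr q + (if ‖hcpSite a h q - hcpSite a h p‖ < 44 * a then (0 : ℝ) else f q) := fun q => by
    simp only [hnr]
    split_ifs <;> simp
  have hsupp : ∀ q ∉ Box, nr q = 0 := fun q hq => by
    simp only [hnr]
    exact if_neg (not_lt.2 (fortyfour_le_of_not_mem_siteBox44 ha hlo p q hq))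
  have hnr_s : Summable nr := summable_of_ne_finset_zero hsupp
  have htsum_nr : ∑' q, nr q = ∑ q ∈ Box, nr q := tsum_eq_sum hsupp
  have htot : ∑' q, f q = ∑ q ∈ Box, nr q + ∑' q, (if ‖hcpSite a h q - hcpSite a h p‖ < 44 * a then (0 : ℝ) else f q) := by
    rw [← htsum_nr, ← hnr_s.tsum_add hGs]
    exact tsum_congr hsplit
  rw [htot, mul_add]
  linarith

/-- **H12⋆ ON THE BOX FROM FIVE CLOSED, FINITE CERTIFICATE STATEMENTS — (PAY) BY DISTANCE.**  Part 92's `coreJointCoercive_cell_of_certificates₁₁`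
with (PAY_fin) replaced by (PAY_near): per representative `p` and offset `s ∈ p1BondOffsets`, the column sum over the sites `q` of the `44a` site box
`Icc(p.1 ± 53) × Icc(p.2.1 ± 69) × Icc(p.2.2 ± 51)` WITH `‖y_q − y_p‖ < 44a` is at most `p1Paym p s − (3/200000)·p1BondW 1 p s`; every ledger at distance
`≥ 44a` is the kernel theorem `payColumn_far_le`.  All five hypotheses ((B∃_fin), (S_fin), (TAB), (PAY_near), (NC∃)) are finite statements, and all three
tails are cut by DISTANCE (44a / 20a / 44a).  NOT a proof of H12⋆ (the five finite hypotheses are verified outside the kernel), NOT summit progress. -/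
theorem coreJointCoercive_cell_of_certificates₁₂ {a h : ℝ} (ha : 0 < a) (hh : 0 < h) (hfam : HcpFamilyMin a h)
    -- (B∃_fin) THE PER-CELL BUDGET at each representative FOR SOME allocation tables that follow the EXACT RULE on the cells ≥ 44a away, asked only for the FINITELY MANY cells of the 44a cell box with a vertex within 44a
    (hB : ∀ p ∈ ({(0, 0, 0), (1, 0, 0)} : Finset (ℤ × ℤ × ℤ)),
      ∃ θ θv : (ℤ × ℤ × ℤ) × (ℤ × ℤ × ℤ) → (ℤ × ℤ × ℤ) × Fin 6 → ℝ,
        (∀ e T, 0 ≤ θ e T) ∧ (∀ e, (Function.support (θ e)).Finite) ∧ (∀ T, (Function.support fun e => θ e T).Finite) ∧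
        (∀ e, p1FarW a h (p1Phi0 p) p e ≠ 0 → ∑ᶠ T, θ e T = 1) ∧
        (∀ e T, θ e T ≠ 0 → ∃ m m' : Fin 4, e.1 = T.1 + p1VertOff (p1Par T.1) T.2 m ∧
          e.1 + e.2 = T.1 + p1VertOff (p1Par T.1) T.2 m') ∧
        (∀ e T, 0 ≤ θv e T) ∧ (∀ e, (Function.support (θv e)).Finite) ∧ (∀ T, (Function.support fun e => θv e T).Finite) ∧
        (∀ e, (∑ i : Fin 3, (2 / 3) * ((if e.2 = p1RouteOff e.1 i then p1FarWv a h (p1Phi0 p) p e.1 else 0) +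
          (if p1RouteOff (e.1 - (p1SV - e.2)) i = p1SV - e.2 then p1FarWv a h (p1Phi0 p) p (e.1 - (p1SV - e.2)) else 0))) ≠ 0 → ∑ᶠ T, θv e T = 1) ∧
        (∀ e T, θv e T ≠ 0 → ∃ m m' : Fin 4, e.1 = T.1 + p1VertOff (p1Par T.1) T.2 m ∧
          e.1 + e.2 = T.1 + p1VertOff (p1Par T.1) T.2 m') ∧
        (∀ T : (ℤ × ℤ × ℤ) × Fin 6, (∀ m : Fin 4, 44 * a ≤ ‖hcpSite a h (T.1 + p1VertOff (p1Par T.1) T.2 m) - hcpSite a h p‖) →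
          ∀ e, θ e T = p1ThetaX a h p e T ∧ θv e T = p1ThetaX a h p e T) ∧
        ∀ (T : (ℤ × ℤ × ℤ) × Fin 6), T.1 ∈ p1CellBox44 p →
          (∃ m : Fin 4, ‖hcpSite a h (T.1 + p1VertOff (p1Par T.1) T.2 m) - hcpSite a h p‖ < 44 * a) → ∀ (G : Fin 3 → Fin 3 → ℝ),
      (∑ᶠ e : (ℤ × ℤ × ℤ) × (ℤ × ℤ × ℤ), θ e T * p1FarW a h (p1Phi0 p) p e *
          fpSq (fun k => (hcpSite a h (e.1 + e.2) 0 - hcpSite a h e.1 0) * G 0 k +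
            (hcpSite a h (e.1 + e.2) 1 - hcpSite a h e.1 1) * G 1 k + (hcpSite a h (e.1 + e.2) 2 - hcpSite a h e.1 2) * G 2 k)) +
      (∑ᶠ e : (ℤ × ℤ × ℤ) × (ℤ × ℤ × ℤ), θv e T *
          (∑ i : Fin 3, (2 / 3) * ((if e.2 = p1RouteOff e.1 i then p1FarWv a h (p1Phi0 p) p e.1 else 0) +
            (if p1RouteOff (e.1 - (p1SV - e.2)) i = p1SV - e.2 then p1FarWv a h (p1Phi0 p) p (e.1 - (p1SV - e.2)) else 0))) *
          fpSq (fun k => (hcpSite a h (e.1 + e.2) 0 - hcpSite a h e.1 0) * G 0 k +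
            (hcpSite a h (e.1 + e.2) 1 - hcpSite a h e.1 1) * G 1 k + (hcpSite a h (e.1 + e.2) 2 - hcpSite a h e.1 2) * G 2 k)) +
      p1CellDefectG a h (fun y k l => (193 / 125) * ((7 * (5 / 4 : ℝ) + 3 / 4) / 4) * fpChi ((81 / 20 * a) ^ 2) ((27 / 5 * a) ^ 2) (y - fun k => hcpSite a h p k) ^ 2 *
          (fpSq (y - fun k => hcpSite a h p k))⁻¹ ^ 5 * ((y - fun k => hcpSite a h p k) k * (y - fun k => hcpSite a h p k) l)) T G ≤
      (193 / 125) * ((5 / 2 * (1 / 24 * fpSymSq G) + 5 / 2 * (1 / 24 * (fpFrob G - fpSymSq G))) *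
        ∫ y in p1RealCell a h T, fpChi ((81 / 20 * a) ^ 2) ((27 / 5 * a) ^ 2) (y - fun k => hcpSite a h p k) ^ 2 * (fpSq (y - fun k => hcpSite a h p k))⁻¹ ^ 3))
    -- (S) per-site domination off the PINNED reach set at the FINITELY MANY sites of the 20a index box with `‖y_q − y_p‖ < 20a`; (TAB) the PINNED certified tables
    (hS : ∀ p ∈ ({(0, 0, 0), (1, 0, 0)} : Finset (ℤ × ℤ × ℤ)),
      ∀ q ∈ Finset.Icc (p.1 - 26) (p.1 + 26) ×ˢ (Finset.Icc (p.2.1 - 34) (p.2.1 + 34) ×ˢ Finset.Icc (p.2.2 - 23) (p.2.2 + 23)),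
      q ∉ p1QB p → q ≠ p → ‖hcpSite a h q - hcpSite a h p‖ < 20 * a → ∀ z : Fin 3 → ℝ,
      0 ≤ 1 / 2 * (ljSqDeriv (‖hcpSite a h q - hcpSite a h p‖ ^ 2) * fpSq z +
          2 * (1 / 2 * (7 * ((‖hcpSite a h q - hcpSite a h p‖ ^ 2)⁻¹) ^ 8 -
            4 * ((‖hcpSite a h q - hcpSite a h p‖ ^ 2)⁻¹) ^ 5)) * p1NRad a h p (fun _ => z) q ^ 2) +
        p1SiteBare a h (fun y k l => (193 / 125) * ((7 * (5 / 4 : ℝ) + 3 / 4) / 4) * fpChi ((81 / 20 * a) ^ 2) ((27 / 5 * a) ^ 2) (y - fun k => hcpSite a h p k) ^ 2 *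
          (fpSq (y - fun k => hcpSite a h p k))⁻¹ ^ 5 * ((y - fun k => hcpSite a h p k) k * (y - fun k => hcpSite a h p k) l)) (fun _ => z) q -
        p1SiteBare a h (fun y k l => (193 / 125) * ((3 / 4 : ℝ) / 4) * fpChi ((81 / 20 * a) ^ 2) ((27 / 5 * a) ^ 2) (y - fun k => hcpSite a h p k) ^ 2 *
          (fpSq (y - fun k => hcpSite a h p k))⁻¹ ^ 4 * (if k = l then 1 else 0)) (fun _ => z) q)
    (hTab : ∀ p ∈ ({(0, 0, 0), (1, 0, 0)} : Finset (ℤ × ℤ × ℤ)), ∀ q ∈ p1QB p, q ≠ p → ∀ z : Fin 3 → ℝ,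
      (p1LU p q).1 * p1NRad a h p (fun _ => z) q ^ 2 ≤
        p1SiteBare a h (fun y k l => (193 / 125) * ((7 * (5 / 4 : ℝ) + 3 / 4) / 4) * fpChi ((81 / 20 * a) ^ 2) ((27 / 5 * a) ^ 2) (y - fun k => hcpSite a h p k) ^ 2 *
          (fpSq (y - fun k => hcpSite a h p k))⁻¹ ^ 5 * ((y - fun k => hcpSite a h p k) k * (y - fun k => hcpSite a h p k) l)) (fun _ => z) q ∧
      p1SiteBare a h (fun y k l => (193 / 125) * ((3 / 4 : ℝ) / 4) * fpChi ((81 / 20 * a) ^ 2) ((27 / 5 * a) ^ 2) (y - fun k => hcpSite a h p k) ^ 2 *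
          (fpSq (y - fun k => hcpSite a h p k))⁻¹ ^ 4 * (if k = l then 1 else 0)) (fun _ => z) q ≤ (p1LU p q).2 * fpSq z)
    -- (PAY_near) the far table's column sums over the FINITELY MANY sites of the 44a box WITHIN 44a of y_p, by the PINNED payments minus the kernel's far allowance
    (hPAY : ∀ p ∈ ({(0, 0, 0), (1, 0, 0)} : Finset (ℤ × ℤ × ℤ)), ∀ s ∈ p1BondOffsets, (193 / 125) * (2 / 5) / a ^ 4 *
      (∑ q ∈ Finset.Icc (p.1 - 53) (p.1 + 53) ×ˢ (Finset.Icc (p.2.1 - 69) (p.2.1 + 69) ×ˢ Finset.Icc (p.2.2 - 51) (p.2.2 + 51)),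
        if ‖hcpSite a h q - hcpSite a h p‖ < 44 * a then
          p1RecTable a h (p1SplitDensity (81 / 20 * a) (27 / 5 * a)) (decide (Even p.1)) (q - p) s else 0) ≤
      p1Paym p s - 3 / 200000 * p1BondW (fun _ => (1 : ℝ)) p s)
    -- (NC∃) THE NEAR CERTIFICATE WITH THE EXACT COLLAR FLUX at both representatives, FOR SOME stencilled decaying finitely supported near tables
    (hNC : ∃ M₁ N : Bool → (ℤ × ℤ × ℤ) → (ℤ × ℤ × ℤ) → (ℤ × ℤ × ℤ) → ℝ, ∃ QT : (ℤ × ℤ × ℤ) → Finset (ℤ × ℤ × ℤ),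
      (∀ b d s s', s ∉ p1BondOffsets ∨ s' ∉ p1BondOffsets → M₁ b d s s' = 0 ∧ N b d s s' = 0) ∧
      (∃ C₁ : ℝ, ∀ p q : ℤ × ℤ × ℤ, ∀ s s', |M₁ (decide (Even p.1)) (q - p) s s'| ≤
        C₁ * ((1 + ‖hcpSite a h q - hcpSite a h p‖)⁻¹) ^ 6 ∧
      |N (decide (Even p.1)) (q - p) s s'| ≤ C₁ * ((1 + ‖hcpSite a h q - hcpSite a h p‖)⁻¹) ^ 6) ∧
      (∀ p ∈ ({(0, 0, 0), (1, 0, 0)} : Finset (ℤ × ℤ × ℤ)), ∀ q : ℤ × ℤ × ℤ, q ∉ QT p → ∀ s s',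
      M₁ (decide (Even p.1)) (q - p) s s' = 0 ∧ M₁ (decide (Even q.1)) (p - q) s s' = 0 ∧
      N (decide (Even p.1)) (q - p) s s' = 0 ∧ N (decide (Even q.1)) (p - q) s' s = 0) ∧
      ∀ p ∈ ({(0, 0, 0), (1, 0, 0)} : Finset (ℤ × ℤ × ℤ)), ∀ V : ℤ × ℤ × ℤ → (Fin 3 → ℝ), V p = 0 →
      (∀ Z : Fin 3 → Fin 3 → ℝ, (∀ j k, Z j k = -Z k j) →
        ∑ q ∈ (if Even p.1 then hcpStarIdx.image (fun d => d + p) else hcpStarIdx.image (fun d => p - d)), ∑ k : Fin 3, V q k * (∑ j : Fin 3, (hcpSite a h q j - hcpSite a h p j) * Z j k) = 0) →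
      0 ≤ p1NearForm a h (1 / 3) (1 / 12) (193 / 125) p p1Stencil (p1Beta a h) M₁ N (p1FarW a h (p1Phi0 p) p) p1SV (p1FarWv a h (p1Phi0 p) p) (fun s => -p1Beta a h (decide (Even p.1)) 0 s) (if Even p.1 then hcpStarIdx.image (fun d => d + p) else hcpStarIdx.image (fun d => p - d)) (p1QB p) (QT p) ∅ (p1FarLegs (p1Phi0 p) p) (fun q => (p1LU p q).1) (fun q => (p1LU p q).2) (p1Paym p) (fun _ => 0) (fun _ _ => 0) V -
        193 / 125 * p1ExactFluxSum a h p V) :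
    CoreJointCoercive a h (1 / 3) (1 / 12) :=
  coreJointCoercive_cell_of_certificates₁₀ ha hh hfam hB hS hTab
    (fun p hp s hs => payColumn_le_of_near ha hh hfam p s (hPAY p hp s hs)) hNC

end Summit.AtomisticToContinuum.Crystallization.Theorems.StrictSplittingRuleBirth

end
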